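import Summits.ValiantsHypothesis.ValiantsHypothesis.Theses.DivisionGap
import Literature.Computability.AlgebraicComplexity.PermanentIrreducible
import Literature.Computability.AlgebraicComplexity.StandardFamiliesProofs
import Literature.Computability.AlgebraicComplexity.RankOneDeterminantalExpressionsProofs

/-!
# `DivisionGap.PerCofactorDegreeReduction` (stmt-ValiantsHypothesis-15046), line `Sketch`:
# the strict inequality `deg Vᵢ < N` of `stub_twoTowerCollapse` is LOAD-BEARING, and square descent
# does not extend to cubes — negative knowledge from the standing disprover

`stub_twoTowerCollapse` (card `abc-tower-collapse`): for nonnegative forms `V₁, V₂, u, u'` in the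
`n × n` variables (`n ≥ 3`) with `deg Vᵢ < N` and `per_n ∣ V₁ u^N + V₂ u'^N` over `ℝ`, one of
`per ∣ u`, `per ∣ u'`, `per ∣ c V₁ + V₂`, `per ∣ u + c u'` (`c > 0`) holds.  The stub is plausible
(valuations in the UFD `ℂ[x]/(per_n)`).  Recorded here, kernel-checked:

* `one_le_degreeOf_of_perPoly_dvd` — the tool: **a nonzero multiple of `per_n` (signed cofactor
  allowed) involves every one of the `n²` variables** (`degreeOf_perPoly = 1` and additivity of
  `degreeOf` over a domain); so `per ∤ f` as soon as one variable is missing from `f ≠ 0`.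
* `twoTowerCollapse_false_without_strict` — with `deg Vᵢ < N` weakened to `deg Vᵢ ≤ N` the stub is
  FALSE at `n = 3`, `N = 1`: `V₁ = x₀₀`, `V₂ = x₁₀`, `u = x₀₀ P₀₀ + x₂₀ P₂₀`, `u' = x₀₀ P₁₀`
  (`P_{i0}` the permanental minors of column `0`), because `x₀₀ u + x₁₀ u' = x₀₀ · per₃` while
  `u, u', u + c u'` miss the variable `x₁₀` and `c x₀₀ + x₁₀` misses `x₂₂`.
* `twoTowerCollapse_false_without_strict_odd` — the same at `N = 3` with the genuine towers
  `V₁ = x₀₀³`, `V₂ = x₁₀³`: `x₀₀ u ≡ −x₁₀ u' (mod per₃)` cubes to `x₀₀³ u³ + x₁₀³ u'³ ∈ (per₃)`.  So the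
  threshold `deg V < N` of the stub is exactly sharp for every odd `N` (mechanism: splitting the
  support of a nonnegative multiple `x₀₀ · per₃` by the variable `x₁₀` gives a POSITIVE two-term
  relation `x₀₀ u + x₁₀ u' ∈ (per)` with neither term in `(per)`).
* `not_cubeDescent` — `stub_squareDescent` (`per ∣ Σ u_t² ⇒ per ∣ u_t`, real algebra) has no odd
  analogue: `per₃ ∣ (x₀₀ u)³ + (x₁₀ u')³` with `per₃ ∤ x₀₀ u`.  (Powers `2^j` descend through squares,
  so the unsquaring tool is exactly matched to the repeated-squaring enemy and to nothing more.)

All statements are inline (no new named facts); `P00, P10, P20, tu, tu'` are the explicit witnesses.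
-/

noncomputable section

namespace Summit.ValiantsHypothesis.Theorems.PerCofactorDegreeReductionNegative

open MvPolynomial Literature.Computability.AlgebraicComplexity
open scoped NNReal

/-! ### The tool: multiples of the permanent use every variable -/

section Tool

variable {ι : Type*} [Fintype ι] [DecidableEq ι] {k : Type*} [CommRing k] [IsDomain k]

/-- **A nonzero multiple of `per` involves every variable**: if `per ∣ f ≠ 0` then
`degreeOf v f ≥ 1` for all cells `v` (the permanent has degree exactly `1` in every variable and
`degreeOf` is additive over a domain). [folklore] -/
theorem one_le_degreeOf_of_perPoly_dvd {f : MvPolynomial (ι × ι) k} (hdvd : perPoly ι k ∣ f)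
    (hf : f ≠ 0) (v : ι × ι) : 1 ≤ degreeOf v f := by
  obtain ⟨w, rfl⟩ := hdvd
  have hw : w ≠ 0 := by
    rintro rfl
    exact hf (mul_zero _)
  rw [degreeOf_mul_eq (perPoly_ne_zero ι k) hw, degreeOf_perPoly k v]
  omega

/-- Contrapositive form: a nonzero polynomial missing a variable is not a multiple of `per`. [folklore] -/
theorem not_perPoly_dvd_of_degreeOf_eq_zero {f : MvPolynomial (ι × ι) k} (hf : f ≠ 0) (v : ι × ι)
    (hv : degreeOf v f = 0) : ¬ perPoly ι k ∣ f := fun hdvd => by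
  have := one_le_degreeOf_of_perPoly_dvd hdvd hf v
  omega

end Tool

/-! ### A small `degreeOf = 0` calculus -/

section DegreeOfZero

variable {σ : Type*} {R : Type*} [CommSemiring R] (v : σ)

/-- [folklore] -/
theorem degreeOf_add_eq_zero {f g : MvPolynomial σ R} (hf : degreeOf v f = 0) (hg : degreeOf v g = 0) :
    degreeOf v (f + g) = 0 :=
  Nat.le_zero.mp ((degreeOf_add_le v f g).trans (by rw [hf, hg, max_self]))

/-- [folklore] -/
theorem degreeOf_mul_eq_zero {f g : MvPolynomial σ R} (hf : degreeOf v f = 0) (hg : degreeOf v g = 0) :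
    degreeOf v (f * g) = 0 :=
  Nat.le_zero.mp ((degreeOf_mul_le v f g).trans (by rw [hf, hg]))

/-- [folklore] -/
theorem degreeOf_pow_eq_zero {f : MvPolynomial σ R} (hf : degreeOf v f = 0) (m : ℕ) :
    degreeOf v (f ^ m) = 0 :=
  Nat.le_zero.mp ((degreeOf_pow_le v f m).trans (by rw [hf, mul_zero]))

/-- [folklore] -/
theorem degreeOf_X_of_ne [DecidableEq σ] [Nontrivial R] {w : σ} (h : v ≠ w) :
    degreeOf v (X w : MvPolynomial σ R) = 0 := by
  rw [degreeOf_X, if_neg h]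

/-- [folklore] -/
theorem degreeOf_C_mul_eq_zero {f : MvPolynomial σ R} (a : R) (hf : degreeOf v f = 0) :
    degreeOf v (C a * f) = 0 :=
  Nat.le_zero.mp ((degreeOf_C_mul_le f v a).trans hf.le)

end DegreeOfZero

/-! ### The witnesses at `n = 3` (column-`0` Laplace expansion) -/

section Witness

variable (R : Type*) [CommSemiring R]

/-- Shorthand for the variable `x_{ij}`, `i j : Fin 3`. -/
abbrev x (i j : Fin 3) : MvPolynomial (Fin 3 × Fin 3) R := X (i, j)

/-- The permanental minor of cell `(0,0)`: `x₁₁x₂₂ + x₂₁x₁₂`. [folklore] -/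
def P00 : MvPolynomial (Fin 3 × Fin 3) R := x R 1 1 * x R 2 2 + x R 2 1 * x R 1 2

/-- The permanental minor of cell `(1,0)`: `x₀₁x₂₂ + x₂₁x₀₂`. [folklore] -/
def P10 : MvPolynomial (Fin 3 × Fin 3) R := x R 0 1 * x R 2 2 + x R 2 1 * x R 0 2

/-- The permanental minor of cell `(2,0)`: `x₀₁x₁₂ + x₁₁x₀₂`. [folklore] -/
def P20 : MvPolynomial (Fin 3 × Fin 3) R := x R 0 1 * x R 1 2 + x R 1 1 * x R 0 2

/-- Laplace expansion of `per₃` along column `0` (tree: `permanent_fin_three`). [folklore] -/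
theorem perPoly_three_eq :
    perPoly (Fin 3) R = x R 0 0 * P00 R + x R 1 0 * P10 R + x R 2 0 * P20 R := by
  rw [perPoly, permanent_fin_three, P00, P10, P20]
  simp [Matrix.mvPolynomialX_apply]

/-- The first tower base `u = x₀₀ P₀₀ + x₂₀ P₂₀` (the part of `per₃` off the cell `(1,0)`). [folklore] -/
def tu : MvPolynomial (Fin 3 × Fin 3) R := x R 0 0 * P00 R + x R 2 0 * P20 R

/-- The second tower base `u' = x₀₀ P₁₀`. [folklore] -/
def tu' : MvPolynomial (Fin 3 × Fin 3) R := x R 0 0 * P10 R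

/-- **The positive two-term relation** `x₀₀ · u + x₁₀ · u' = x₀₀ · per₃`. [folklore] -/
theorem key_relation : x R 0 0 * tu R + x R 1 0 * tu' R = x R 0 0 * perPoly (Fin 3) R := by
  rw [perPoly_three_eq, tu, tu']
  ring

variable {R}

/-- Base change of the witnesses along a semiring map. [folklore] -/
theorem map_tu {S : Type*} [CommSemiring S] (φ : R →+* S) : map φ (tu R) = tu S := by
  simp [tu, P00, P20, map_X]

/-- Base change of the witnesses along a semiring map. [folklore] -/
theorem map_tu' {S : Type*} [CommSemiring S] (φ : R →+* S) : map φ (tu' R) = tu' S := by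
  simp [tu', P10, map_X]

end Witness

/-! ### Non-divisibility of the witnesses over `ℝ` -/

section Real

/-- `u` misses the variable `x₁₀`. [folklore] -/
theorem degreeOf_tu : degreeOf ((1 : Fin 3), (0 : Fin 3)) (tu ℝ) = 0 := by
  unfold tu P00 P20 x
  refine degreeOf_add_eq_zero _ (degreeOf_mul_eq_zero _ (degreeOf_X_of_ne _ (by decide))
    (degreeOf_add_eq_zero _ (degreeOf_mul_eq_zero _ (degreeOf_X_of_ne _ (by decide))
      (degreeOf_X_of_ne _ (by decide))) (degreeOf_mul_eq_zero _ (degreeOf_X_of_ne _ (by decide))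
      (degreeOf_X_of_ne _ (by decide)))))
    (degreeOf_mul_eq_zero _ (degreeOf_X_of_ne _ (by decide))
    (degreeOf_add_eq_zero _ (degreeOf_mul_eq_zero _ (degreeOf_X_of_ne _ (by decide))
      (degreeOf_X_of_ne _ (by decide))) (degreeOf_mul_eq_zero _ (degreeOf_X_of_ne _ (by decide))
      (degreeOf_X_of_ne _ (by decide)))))

/-- `u'` misses the variable `x₁₀`. [folklore] -/
theorem degreeOf_tu' : degreeOf ((1 : Fin 3), (0 : Fin 3)) (tu' ℝ) = 0 := by
  unfold tu' P10 x
  exact degreeOf_mul_eq_zero _ (degreeOf_X_of_ne _ (by decide))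
    (degreeOf_add_eq_zero _ (degreeOf_mul_eq_zero _ (degreeOf_X_of_ne _ (by decide))
      (degreeOf_X_of_ne _ (by decide))) (degreeOf_mul_eq_zero _ (degreeOf_X_of_ne _ (by decide))
      (degreeOf_X_of_ne _ (by decide))))

/-- `u(1,…,1) = 4`. [folklore] -/
theorem eval_one_tu : eval (fun _ => (1 : ℝ)) (tu ℝ) = 4 := by
  simp [tu, P00, P20]
  norm_num

/-- `u'(1,…,1) = 2`. [folklore] -/
theorem eval_one_tu' : eval (fun _ => (1 : ℝ)) (tu' ℝ) = 2 := by
  simp [tu', P10]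
  norm_num

/-- `u ≠ 0` over any nontrivial target of `ℝ≥0`/`ℝ`: checked over `ℝ`. [folklore] -/
theorem tu_ne_zero : tu ℝ ≠ 0 := fun h => by
  have := eval_one_tu
  rw [h, map_zero] at this
  norm_num at this

/-- [folklore] -/
theorem tu'_ne_zero : tu' ℝ ≠ 0 := fun h => by
  have := eval_one_tu'
  rw [h, map_zero] at this
  norm_num at this

/-- `per₃ ∤ u`. [folklore] -/
theorem not_perPoly_dvd_tu : ¬ perPoly (Fin 3) ℝ ∣ tu ℝ :=
  not_perPoly_dvd_of_degreeOf_eq_zero tu_ne_zero _ degreeOf_tu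

/-- `per₃ ∤ u'`. [folklore] -/
theorem not_perPoly_dvd_tu' : ¬ perPoly (Fin 3) ℝ ∣ tu' ℝ :=
  not_perPoly_dvd_of_degreeOf_eq_zero tu'_ne_zero _ degreeOf_tu'

/-- `per₃ ∤ u + c u'` for `c ≥ 0` (the sum misses `x₁₀` and is nonzero). [folklore] -/
theorem not_perPoly_dvd_tu_add (c : ℝ) (hc : 0 ≤ c) : ¬ perPoly (Fin 3) ℝ ∣ tu ℝ + C c * tu' ℝ := by
  refine not_perPoly_dvd_of_degreeOf_eq_zero ?_ ((1 : Fin 3), (0 : Fin 3))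
    (degreeOf_add_eq_zero _ degreeOf_tu (degreeOf_C_mul_eq_zero _ c degreeOf_tu'))
  intro h
  have h1 := congrArg (eval (fun _ => (1 : ℝ))) h
  rw [map_add, map_mul, eval_C, eval_one_tu, eval_one_tu', map_zero] at h1
  nlinarith

/-- `per₃ ∤ c x₀₀^m + x₁₀^m` for `c ≥ 0`, `m` arbitrary (misses `x₂₂`, nonzero). [folklore] -/
theorem not_perPoly_dvd_binomial (c : ℝ) (hc : 0 ≤ c) (m : ℕ) :
    ¬ perPoly (Fin 3) ℝ ∣ C c * x ℝ 0 0 ^ m + x ℝ 1 0 ^ m := by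
  refine not_perPoly_dvd_of_degreeOf_eq_zero ?_ ((2 : Fin 3), (2 : Fin 3))
    (degreeOf_add_eq_zero _ (degreeOf_C_mul_eq_zero _ c (degreeOf_pow_eq_zero _
      (degreeOf_X_of_ne _ (by decide)) m)) (degreeOf_pow_eq_zero _ (degreeOf_X_of_ne _ (by decide)) m))
  intro h
  have h1 := congrArg (eval (fun _ => (1 : ℝ))) h
  simp only [map_add, map_mul, eval_C, map_pow, eval_X, one_pow, mul_one, map_zero] at h1
  linarith

end Real

/-! ### Homogeneity bookkeeping over `ℝ≥0` -/

section Homog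

/-- `u` is a cubic form. [folklore] -/
theorem tu_isHomogeneous (R : Type*) [CommSemiring R] : (tu R).IsHomogeneous 3 := by
  unfold tu P00 P20 x
  exact ((isHomogeneous_X R _).mul (((isHomogeneous_X R _).mul (isHomogeneous_X R _)).add
    ((isHomogeneous_X R _).mul (isHomogeneous_X R _)))).add
    ((isHomogeneous_X R _).mul (((isHomogeneous_X R _).mul (isHomogeneous_X R _)).add
    ((isHomogeneous_X R _).mul (isHomogeneous_X R _))))

/-- `u'` is a cubic form. [folklore] -/
theorem tu'_isHomogeneous (R : Type*) [CommSemiring R] : (tu' R).IsHomogeneous 3 := by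
  unfold tu' P10 x
  exact (isHomogeneous_X R _).mul (((isHomogeneous_X R _).mul (isHomogeneous_X R _)).add
    ((isHomogeneous_X R _).mul (isHomogeneous_X R _)))

/-- `u ≠ 0` over `ℝ≥0`. [folklore] -/
theorem tu_nnreal_ne_zero : tu ℝ≥0 ≠ 0 := fun h => by
  have := map_tu (R := ℝ≥0) NNReal.toRealHom
  rw [h, map_zero] at this
  exact tu_ne_zero this.symm

/-- `u' ≠ 0` over `ℝ≥0`. [folklore] -/
theorem tu'_nnreal_ne_zero : tu' ℝ≥0 ≠ 0 := fun h => by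
  have := map_tu' (R := ℝ≥0) NNReal.toRealHom
  rw [h, map_zero] at this
  exact tu'_ne_zero this.symm

/-- [folklore] -/
theorem tu_isHomogeneous_totalDegree : (tu ℝ≥0).IsHomogeneous (tu ℝ≥0).totalDegree := by
  rw [(tu_isHomogeneous ℝ≥0).totalDegree tu_nnreal_ne_zero]
  exact tu_isHomogeneous ℝ≥0

/-- [folklore] -/
theorem tu'_isHomogeneous_totalDegree : (tu' ℝ≥0).IsHomogeneous (tu' ℝ≥0).totalDegree := by
  rw [(tu'_isHomogeneous ℝ≥0).totalDegree tu'_nnreal_ne_zero]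
  exact tu'_isHomogeneous ℝ≥0

/-- A power of a variable is homogeneous of its own total degree. [folklore] -/
theorem X_pow_isHomogeneous_totalDegree (v : Fin 3 × Fin 3) (m : ℕ) :
    ((X v : MvPolynomial (Fin 3 × Fin 3) ℝ≥0) ^ m).IsHomogeneous
      ((X v : MvPolynomial (Fin 3 × Fin 3) ℝ≥0) ^ m).totalDegree := by
  rw [totalDegree_X_pow]
  simpa using (isHomogeneous_X ℝ≥0 v).pow m

end Homog

/-! ### The refutations -/

/-- **`deg Vᵢ < N` is load-bearing in `stub_twoTowerCollapse`.**  With the strict inequalities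
`V₁.totalDegree < N`, `V₂.totalDegree < N` weakened to `≤ N`, the stub is false: `n = 3`, `N = 1`,
`V₁ = x₀₀`, `V₂ = x₁₀`, `u = x₀₀P₀₀ + x₂₀P₂₀`, `u' = x₀₀P₁₀` — then `V₁ u + V₂ u' = x₀₀ · per₃` but
`u`, `u'`, `u + c u'` miss the variable `x₁₀` and `c x₀₀ + x₁₀` misses `x₂₂`, so none is a multiple of
`per₃` (`one_le_degreeOf_of_perPoly_dvd`). [folklore] -/
theorem twoTowerCollapse_false_without_strict :
    ¬ ∀ (n N : ℕ) (V₁ V₂ u u' : MvPolynomial (Fin n × Fin n) ℝ≥0), 3 ≤ n → V₁ ≠ 0 → V₂ ≠ 0 →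
        V₁.IsHomogeneous V₁.totalDegree → V₂.IsHomogeneous V₂.totalDegree →
        u.IsHomogeneous u.totalDegree → u'.IsHomogeneous u'.totalDegree →
        V₁.totalDegree ≤ N → V₂.totalDegree ≤ N →
        perPoly (Fin n) ℝ ∣ MvPolynomial.map NNReal.toRealHom (V₁ * u ^ N + V₂ * u' ^ N) →
        perPoly (Fin n) ℝ ∣ MvPolynomial.map NNReal.toRealHom u ∨
        perPoly (Fin n) ℝ ∣ MvPolynomial.map NNReal.toRealHom u' ∨
        (∃ c : ℝ≥0, 0 < c ∧ perPoly (Fin n) ℝ ∣ MvPolynomial.map NNReal.toRealHom (c • V₁ + V₂)) ∨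
        (∃ c : ℝ≥0, 0 < c ∧ perPoly (Fin n) ℝ ∣ MvPolynomial.map NNReal.toRealHom (u + c • u')) := by
  intro H
  have hV : ∀ v : Fin 3 × Fin 3, ((X v : MvPolynomial (Fin 3 × Fin 3) ℝ≥0)).IsHomogeneous
      (X v : MvPolynomial (Fin 3 × Fin 3) ℝ≥0).totalDegree := fun v => by
    simpa using X_pow_isHomogeneous_totalDegree v 1
  have hdeg : ∀ v : Fin 3 × Fin 3, (X v : MvPolynomial (Fin 3 × Fin 3) ℝ≥0).totalDegree ≤ 1 :=
    fun v => (totalDegree_X (R := ℝ≥0) v).le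
  have hdvd : perPoly (Fin 3) ℝ ∣ MvPolynomial.map NNReal.toRealHom
      (x ℝ≥0 0 0 * tu ℝ≥0 ^ 1 + x ℝ≥0 1 0 * tu' ℝ≥0 ^ 1) := by
    rw [pow_one, pow_one, key_relation, map_mul, map_perPoly]
    exact dvd_mul_left _ _
  rcases H 3 1 (x ℝ≥0 0 0) (x ℝ≥0 1 0) (tu ℝ≥0) (tu' ℝ≥0) le_rfl (X_ne_zero _) (X_ne_zero _)
      (hV _) (hV _) tu_isHomogeneous_totalDegree tu'_isHomogeneous_totalDegree (hdeg _) (hdeg _) hdvd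
    with h | h | ⟨c, hc, h⟩ | ⟨c, hc, h⟩
  · rw [map_tu] at h
    exact not_perPoly_dvd_tu h
  · rw [map_tu'] at h
    exact not_perPoly_dvd_tu' h
  · apply not_perPoly_dvd_binomial (c : ℝ) c.coe_nonneg 1
    simpa [smul_eq_C_mul, map_X] using h
  · apply not_perPoly_dvd_tu_add (c : ℝ) c.coe_nonneg
    simpa [smul_eq_C_mul, map_tu, map_tu'] using h

/-- The real cofactor exhibiting `x₀₀³ u³ + x₁₀³ u'³ ∈ (per₃)`: from `x₀₀ u + x₁₀ u' = x₀₀ per₃`,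
`(x₀₀u)³ + (x₁₀u')³ = (x₀₀u + x₁₀u') · ((x₀₀u)² − (x₀₀u)(x₁₀u') + (x₁₀u')²)`. [folklore] -/
theorem cube_tower_eq :
    x ℝ 0 0 ^ 3 * tu ℝ ^ 3 + x ℝ 1 0 ^ 3 * tu' ℝ ^ 3 = perPoly (Fin 3) ℝ *
      (x ℝ 0 0 * ((x ℝ 0 0 * tu ℝ) ^ 2 - (x ℝ 0 0 * tu ℝ) * (x ℝ 1 0 * tu' ℝ) + (x ℝ 1 0 * tu' ℝ) ^ 2)) := by
  have key := key_relation ℝ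
  calc x ℝ 0 0 ^ 3 * tu ℝ ^ 3 + x ℝ 1 0 ^ 3 * tu' ℝ ^ 3
      = (x ℝ 0 0 * tu ℝ + x ℝ 1 0 * tu' ℝ) *
          ((x ℝ 0 0 * tu ℝ) ^ 2 - (x ℝ 0 0 * tu ℝ) * (x ℝ 1 0 * tu' ℝ) + (x ℝ 1 0 * tu' ℝ) ^ 2) := by ring
    _ = (x ℝ 0 0 * perPoly (Fin 3) ℝ) *
          ((x ℝ 0 0 * tu ℝ) ^ 2 - (x ℝ 0 0 * tu ℝ) * (x ℝ 1 0 * tu' ℝ) + (x ℝ 1 0 * tu' ℝ) ^ 2) := by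
          rw [key]
    _ = _ := by ring

/-- **Sharp for genuine towers too (`N = 3`).**  With `≤ N` in place of `< N` the stub fails at
`n = 3`, `N = 3`, `V₁ = x₀₀³`, `V₂ = x₁₀³` and the same bases: `x₀₀ u ≡ −x₁₀ u' (mod per₃)` cubes to
`x₀₀³u³ + x₁₀³u'³ ∈ (per₃)`, and again no disjunct holds.  The same works for every odd `N`, so the
threshold `deg V < N` cannot be relaxed at any odd exponent. [folklore] -/
theorem twoTowerCollapse_false_without_strict_odd :
    ¬ ∀ (n N : ℕ) (V₁ V₂ u u' : MvPolynomial (Fin n × Fin n) ℝ≥0), 3 ≤ n → V₁ ≠ 0 → V₂ ≠ 0 →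
        V₁.IsHomogeneous V₁.totalDegree → V₂.IsHomogeneous V₂.totalDegree →
        u.IsHomogeneous u.totalDegree → u'.IsHomogeneous u'.totalDegree →
        V₁.totalDegree ≤ N → V₂.totalDegree ≤ N → 2 ≤ N →
        perPoly (Fin n) ℝ ∣ MvPolynomial.map NNReal.toRealHom (V₁ * u ^ N + V₂ * u' ^ N) →
        perPoly (Fin n) ℝ ∣ MvPolynomial.map NNReal.toRealHom u ∨
        perPoly (Fin n) ℝ ∣ MvPolynomial.map NNReal.toRealHom u' ∨
        (∃ c : ℝ≥0, 0 < c ∧ perPoly (Fin n) ℝ ∣ MvPolynomial.map NNReal.toRealHom (c • V₁ + V₂)) ∨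
        (∃ c : ℝ≥0, 0 < c ∧ perPoly (Fin n) ℝ ∣ MvPolynomial.map NNReal.toRealHom (u + c • u')) := by
  intro H
  have hdeg : ∀ v : Fin 3 × Fin 3, ((X v : MvPolynomial (Fin 3 × Fin 3) ℝ≥0) ^ 3).totalDegree ≤ 3 :=
    fun v => (totalDegree_X_pow (R := ℝ≥0) v 3).le
  have hdvd : perPoly (Fin 3) ℝ ∣ MvPolynomial.map NNReal.toRealHom
      (x ℝ≥0 0 0 ^ 3 * tu ℝ≥0 ^ 3 + x ℝ≥0 1 0 ^ 3 * tu' ℝ≥0 ^ 3) := by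
    simp only [map_add, map_mul, map_pow, map_X, map_tu, map_tu']
    exact ⟨_, cube_tower_eq⟩
  rcases H 3 3 (x ℝ≥0 0 0 ^ 3) (x ℝ≥0 1 0 ^ 3) (tu ℝ≥0) (tu' ℝ≥0) le_rfl
      (pow_ne_zero _ (X_ne_zero _)) (pow_ne_zero _ (X_ne_zero _))
      (X_pow_isHomogeneous_totalDegree _ 3) (X_pow_isHomogeneous_totalDegree _ 3)
      tu_isHomogeneous_totalDegree tu'_isHomogeneous_totalDegree (hdeg _) (hdeg _) (by norm_num) hdvd
    with h | h | ⟨c, hc, h⟩ | ⟨c, hc, h⟩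
  · rw [map_tu] at h
    exact not_perPoly_dvd_tu h
  · rw [map_tu'] at h
    exact not_perPoly_dvd_tu' h
  · apply not_perPoly_dvd_binomial (c : ℝ) c.coe_nonneg 3
    simpa [smul_eq_C_mul, map_X] using h
  · apply not_perPoly_dvd_tu_add (c : ℝ) c.coe_nonneg
    simpa [smul_eq_C_mul, map_tu, map_tu'] using h

/-- **Square descent has no cubic analogue.**  `stub_squareDescent` (`per_n ∣ Σ_t u_t² ⇒ per_n ∣ u_t`
over `ℝ`) rests on sums of real squares; for cubes it fails: `per₃ ∣ (x₀₀u)³ + (x₁₀u')³` while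
`per₃ ∤ x₀₀ u`. [folklore] -/
theorem not_cubeDescent :
    ¬ ∀ (n : ℕ) (ι : Type) [Fintype ι] (w : ι → MvPolynomial (Fin n × Fin n) ℝ),
        perPoly (Fin n) ℝ ∣ ∑ t, w t ^ 3 → ∀ t, perPoly (Fin n) ℝ ∣ w t := by
  intro H
  have hsum : ∑ t, (![x ℝ 0 0 * tu ℝ, x ℝ 1 0 * tu' ℝ] t) ^ 3 =
      x ℝ 0 0 ^ 3 * tu ℝ ^ 3 + x ℝ 1 0 ^ 3 * tu' ℝ ^ 3 := by
    rw [Fin.sum_univ_two]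
    simp only [Matrix.cons_val_zero, Matrix.cons_val_one]
    ring
  have h := H 3 (Fin 2) ![x ℝ 0 0 * tu ℝ, x ℝ 1 0 * tu' ℝ] (by rw [hsum]; exact ⟨_, cube_tower_eq⟩) 0
  simp only [Matrix.cons_val_zero] at h
  refine not_perPoly_dvd_of_degreeOf_eq_zero (mul_ne_zero (X_ne_zero _) tu_ne_zero) ((1 : Fin 3), (0 : Fin 3))
    (degreeOf_mul_eq_zero _ (degreeOf_X_of_ne _ (by decide)) degreeOf_tu) h

end Summit.ValiantsHypothesis.Theorems.PerCofactorDegreeReductionNegative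

end
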